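import Summits.AtomisticToContinuum.HydrodynamicLimit.Theses.SimpleMaterialRetardation
import Literature.MathematicalPhysics.KineticTheory.HardSphereEulerProofs
import Literature.MathematicalPhysics.KineticTheory.HardSphereEulerDim
import Literature.MathematicalPhysics.KineticTheory.HardSphereTwoTimePressure
import Literature.Analysis.FluidPDE.HardSphereAlexander
import Literature.Analysis.FunctionSpaces.TorusCalculus
import Literature.Analysis.FunctionSpaces.TorusMollifier

/-!
# Line `calibrated-split` for the crux `CalibratedClosureInBand` (stmt-AtomisticToContinuum-17918)

Route `SimpleMaterialRetardation`, crux
`CalibratedClosureInBand := StressIsotropy → VirialLocalEquilibrium → EquilibriumCalibration →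
NoConcentrationInBand → FluxLocalityInBand` (the glue of the mechanism, in band).

THE LINE IS THE STRATEGIST'S TYPED SPLIT of the crux along its own proof plan, with every
bookkeeping step PROVED here and the analysis isolated in three registered stubs:

* piece 1 `VirialResponseCalibration` (IDENTIFICATION; local def, = children.json item 1):
  `VirialLocalEquilibrium → EquilibriumCalibration →` the enslaved-virial law holds verbatim with a
  continuous response `ζ` that agrees with the equation of state, `ζ = hsCompressibility − 1` on a
  band `(0, ηs]`.  PROVED from `stub_coarsePressureLLN` (`VirialResponseCalibration_of`): keep the
  `ζ, η₁` of VLE; for `η ∈ (0, ηs]` put `σ := η^{1/3}`; flows exist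
  (`HardSphereFlow.nonempty_torus_holds`), LG laws are probability measures
  (`isProbabilityMeasure_localGibbsLaw`), constants solve hs-Euler
  (`IsHardSphereEulerSolutionDim.const`), `EquilibriumCalibration` (a) at `τ = 0` is the `t = 0`
  LLN, kernels in `B_r` exist (`Torus.kernel`); if `ζ(σ³) ≠ Z(σ³) − 1` then the VLE event, the
  stub's LLN event and `EquilibriumCalibration` (b), all at `δ := ‖a − b‖/8`, cover phase space —
  contradiction with `LG(univ) = 1`.
* piece 2 `ExcessFluxTransferInBand` (TRANSFER; local def, = children.json item 2): that calibrated
  law `→ NoConcentrationInBand →` `W_N(∇χ)/3 ≈ ∫∫momFlux − ∫∫momFlux0` and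
  `W^V_N(∇χ)/3 ≈ ∫∫enFlux − ∫∫enFlux0` in band, in LG-probability.  PROVED from
  `stub_excessMomentumIdentity`, `stub_excessEnergyIdentity` (`ExcessFluxTransferInBand_of`):
  thresholds `η₁ := min (min η₁^V η₁^N) (ηs/2)`, VLE event at `3κ` with `g := ∇χ`
  (`IsSmooth.gradient`), the `c = 2` no-concentration event turned into the band
  `ρ_φσ³ ≤ ηs` by the packing guard, the identities on the good set
  (`ae_mem_good_localGibbsLaw`), union bound with an LG-null set.
* assembly `calibratedClosureInBand_of_pieces : piece 1 → piece 2 → CalibratedClosureInBand`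
  (PROVED, = the glue item of the split; step (iii) of the crux): `StressIsotropy` at `κ/2` + the
  excess-flux law at `κ/2`, minima of thresholds / `σ₀`'s / radii, the pathwise identity
  `ΔM − ∫∫F = (ΔM − ∫∫F₀ − W/3) + (W/3 − (∫∫F − ∫∫F₀))`, outer-measure subadditivity, squeeze.
* `CalibratedClosureInBand_of : CalibratedClosureInBand` from the three `stub_*` (kernel-checked;
  the sorry-free content is `calibratedClosureInBand_of_pieces ∘ (VirialResponseCalibration_of,
  ExcessFluxTransferInBand_of)`, axioms propext / Classical.choice / Quot.sound).

Registered stubs: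
* `stub_coarsePressureLLN` (M/L, hardest) — LLN for `∫_s^t∫ 3ρ_φθ_φ ζ(ρ_φσ³) g` INSIDE the time
  integral under the constant-profile LG laws, given field convergence at every `τ ≥ 0`;
* `stub_excessMomentumIdentity` (M) — along a GOOD trajectory in the calibrated band,
  `∫∫momFlux − ∫∫momFlux0 = 3⁻¹ • ∫∫ 3ρ_φθ_φζ(ρ_φσ³) ∇χ` (integrability along the trajectory,
  `hsPressure σ ρ θ = ρθZ(ρσ³)` by definition, `ζ = Z − 1` on the band, vacuum cells `0 = 0`);
* `stub_excessEnergyIdentity` (M) — the energy twin.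
Disproof used: none (no `Disproof.lean` for this crux yet).  Costume check: no stub mentions
`StressIsotropy`, `VirialLocalEquilibrium`, `FluxLocalityInBand` or the Statement; stub 1 is an
equilibrium LLN, stubs 2–3 are deterministic integral identities.
planner-cstrat-stmt-AtomisticToContinuum-17918-r1-0, 2026-08-17.
-/

namespace Summit.AtomisticToContinuum.HydrodynamicLimit.Cruxes.CalibratedClosureInBand.CalibratedSplit

open scoped BigOperators Topology Manifold Classical MeasureTheory ProbabilityTheory Matrix InnerProductSpace ComplexConjugate ContinuousMap ENNReal
open Filter Set Function TopologicalSpace MeasureTheory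
open Summit.AtomisticToContinuum.HydrodynamicLimit.Theses.SimpleMaterialRetardation
open Literature.MathematicalPhysics.KineticTheory Literature.Analysis.FluidPDE Literature.Analysis.FunctionSpaces

/-! ## The two pieces (local copies until the route split is filed) -/

/-- PIECE 1 (identification) — verbatim children.json item `VirialResponseCalibration`. -/
def VirialResponseCalibration : Prop :=
  open Literature.MathematicalPhysics.KineticTheory Literature.Analysis.FluidPDE Literature.Analysis.FunctionSpaces in VirialLocalEquilibrium → EquilibriumCalibration → let ρK : {n : ℕ} → (T3 → ℝ) → Config (n) (Fin 3) T3 → T3 → ℝ := fun φ z x => empiricalDensityField z (fun y => φ (x - y)); let mK : {n : ℕ} → (T3 → ℝ) → Config (n) (Fin 3) T3 → T3 → V3 := fun φ z x => empiricalMomentumField z (fun y => φ (x - y)); let eK : {n : ℕ} → (T3 → ℝ) → Config (n) (Fin 3) T3 → T3 → ℝ := fun φ z x => empiricalEnergyField z (fun y => φ (x - y)); let θC : ℝ → V3 → ℝ → ℝ := fun ρ' m e => 2 / 3 * (e / ρ' - ‖m‖ ^ 2 / (2 * ρ' ^ 2)); let W : (N : ℕ) → ℝ → (T3 → V3) → ℝ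 → ℝ → (ℝ → Config (N + 1) (Fin 3) T3) → V3 := fun N σ' g s t γ => (((N : ℝ) + 1)⁻¹) • ∑ᶠ τ ∈ collisionTimes (Torus.geometry (Fin 3)) (hsDiameter σ' N) γ ∩ Set.Ioc s t, ∑ i : Fin (N + 1), ∑ j : Fin (N + 1), (if i < j then Set.indicator (contactSet (Torus.geometry (Fin 3)) (N + 1) (hsDiameter σ' N) i j) (fun z' => inner ℝ ((Torus.geometry (Fin 3)).sepVec (z' i).1 (z' j).1) ((z' i).2 - (Function.leftLim γ τ i).2) • g (z' i).1) (γ τ) else 0); let WV : (N : ℕ) → ℝ → (T3 → V3) → ℝ → ℝ → (ℝ → Config (N + 1) (Fin 3) T3) → ℝ := fun N σ' g s t γ => (((N : ℝ) + 1)⁻¹) * ∑ᶠ τ ∈ collisionTimes (Torus.geometry (Fin 3)) (hsDiameter σ' N) γ ∩ Set.Ioc s t, ∑ i : Fin (N + 1), ∑ j : Fin (N + 1), (if i < j then Set.indicator (contactSet (Torus.geometry (Fin 3)) (N + 1) (hsDiameter σ' N) i j) (fun z' => inner ℝ ((Torus.geometry (Fin 3)).sepVec (z' i).1 (z' j).1)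 ((z' i).2 - (Function.leftLim γ τ i).2) * inner ℝ (g (z' i).1) ((2 : ℝ)⁻¹ • ((z' i).2 + (z' j).2))) (γ τ) else 0); ∃ ζ : ℝ → ℝ, Continuous ζ ∧ (∃ ηs : ℝ, 0 < ηs ∧ ∀ η : ℝ, 0 < η → η ≤ ηs → ζ η = hsCompressibility η - 1) ∧ ∃ η₁ : ℝ, 0 < η₁ ∧ ∀ (a₀ θ₀ : T3 → ℝ) (u₀ : T3 → V3), Continuous a₀ → Continuous θ₀ → Continuous u₀ → (∀ x, 0 < a₀ x) → (∀ x, 0 < θ₀ x) → ∃ σ₀ : ℝ, 0 < σ₀ ∧ ∀ σ : ℝ, 0 < σ → σ < σ₀ → ∀ (T : ℝ) (ρ θ : ℝ → T3 → ℝ) (u : ℝ → T3 → V3), IsHardSphereEulerSolution σ T ρ u θ → (∀ τ ∈ Set.Ico 0 T, ∀ x, ρ τ x * σ ^ 3 ≤ η₁) → ∀ Φ : (N : ℕ) → HardSphereFlow (Torus.geometry (Fin 3)) (hsDiameter σ N) (N + 1), TendstoHydroFieldsAt (fun N => localGibbsLaw σ a₀ u₀ θ₀ N (Φ N)) Φ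 ρ u θ 0 → ∀ s t : ℝ, 0 ≤ s → s ≤ t → t < T → ∀ g : T3 → V3, Continuous g → ∀ κ : ℝ, 0 < κ → ∃ r : ℝ, 0 < r ∧ ∀ φ : T3 → ℝ, Continuous φ → (∀ y, 0 ≤ φ y) → ∫ y, φ y = 1 → (∀ y, r ≤ ‖y‖ → φ y = 0) → Filter.Tendsto (fun N : ℕ => localGibbsLaw σ a₀ u₀ θ₀ N (Φ N) {z | κ < ‖W N σ g s t (fun τ => (Φ N).flow τ z) - ∫ τ in Set.Ioc s t, ∫ x, (3 * (ρK φ ((Φ N).flow τ z) x * θC (ρK φ ((Φ N).flow τ z) x) (mK φ ((Φ N).flow τ z) x) (eK φ ((Φ N).flow τ z) x)) * ζ (ρK φ ((Φ N).flow τ z) x * σ ^ 3)) • g x‖ ∨ κ < |WV N σ g s t (fun τ => (Φ N).flow τ z) - ∫ τ in Set.Ioc s t, ∫ x, (3 * (ρK φ ((Φ N).flow τ z) x * θC (ρK φ ((Φ N).flow τ z) x) (mK φ ((Φ N).flow τ z) x) (eK φ ((Φ N).flow τ z) x)) * ζ (ρK φ ((Φ N).flow τ z) x * σ ^ 3)) /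 ρK φ ((Φ N).flow τ z) x * inner ℝ (mK φ ((Φ N).flow τ z) x) (g x)|}) Filter.atTop (nhds 0)

/-- PIECE 2 (transfer) — verbatim children.json item `ExcessFluxTransferInBand`. -/
def ExcessFluxTransferInBand : Prop :=
  open Literature.MathematicalPhysics.KineticTheory Literature.Analysis.FluidPDE Literature.Analysis.FunctionSpaces in (let ρK : {n : ℕ} → (T3 → ℝ) → Config (n) (Fin 3) T3 → T3 → ℝ := fun φ z x => empiricalDensityField z (fun y => φ (x - y)); let mK : {n : ℕ} → (T3 → ℝ) → Config (n) (Fin 3) T3 → T3 → V3 := fun φ z x => empiricalMomentumField z (fun y => φ (x - y)); let eK : {n : ℕ} → (T3 → ℝ) → Config (n) (Fin 3) T3 → T3 → ℝ := fun φ z x => empiricalEnergyField z (fun y => φ (x - y)); let θC : ℝ → V3 → ℝ → ℝ := fun ρ' m e => 2 / 3 * (e / ρ' - ‖m‖ ^ 2 / (2 * ρ' ^ 2)); let W : (N : ℕ) → ℝ → (T3 → V3) → ℝ → ℝ → (ℝ → Config (N + 1) (Fin 3) T3) → V3 := fun N σ' g s t γ => (((N : ℝ) + 1)⁻¹) • ∑ᶠ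 τ ∈ collisionTimes (Torus.geometry (Fin 3)) (hsDiameter σ' N) γ ∩ Set.Ioc s t, ∑ i : Fin (N + 1), ∑ j : Fin (N + 1), (if i < j then Set.indicator (contactSet (Torus.geometry (Fin 3)) (N + 1) (hsDiameter σ' N) i j) (fun z' => inner ℝ ((Torus.geometry (Fin 3)).sepVec (z' i).1 (z' j).1) ((z' i).2 - (Function.leftLim γ τ i).2) • g (z' i).1) (γ τ) else 0); let WV : (N : ℕ) → ℝ → (T3 → V3) → ℝ → ℝ → (ℝ → Config (N + 1) (Fin 3) T3) → ℝ := fun N σ' g s t γ => (((N : ℝ) + 1)⁻¹) * ∑ᶠ τ ∈ collisionTimes (Torus.geometry (Fin 3)) (hsDiameter σ' N) γ ∩ Set.Ioc s t, ∑ i : Fin (N + 1), ∑ j : Fin (N + 1), (if i < j then Set.indicator (contactSet (Torus.geometry (Fin 3)) (N + 1) (hsDiameter σ' N) i j) (fun z' => inner ℝ ((Torus.geometry (Fin 3)).sepVec (z' i).1 (z' j).1) ((z' i).2 - (Function.leftLim γ τ i).2) * inner ℝ (g (z' i).1) ((2 : ℝ)⁻¹ • ((z' i).2 + (z' j).2)))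 (γ τ) else 0); ∃ ζ : ℝ → ℝ, Continuous ζ ∧ (∃ ηs : ℝ, 0 < ηs ∧ ∀ η : ℝ, 0 < η → η ≤ ηs → ζ η = hsCompressibility η - 1) ∧ ∃ η₁ : ℝ, 0 < η₁ ∧ ∀ (a₀ θ₀ : T3 → ℝ) (u₀ : T3 → V3), Continuous a₀ → Continuous θ₀ → Continuous u₀ → (∀ x, 0 < a₀ x) → (∀ x, 0 < θ₀ x) → ∃ σ₀ : ℝ, 0 < σ₀ ∧ ∀ σ : ℝ, 0 < σ → σ < σ₀ → ∀ (T : ℝ) (ρ θ : ℝ → T3 → ℝ) (u : ℝ → T3 → V3), IsHardSphereEulerSolution σ T ρ u θ → (∀ τ ∈ Set.Ico 0 T, ∀ x, ρ τ x * σ ^ 3 ≤ η₁) → ∀ Φ : (N : ℕ) → HardSphereFlow (Torus.geometry (Fin 3)) (hsDiameter σ N) (N + 1), TendstoHydroFieldsAt (fun N => localGibbsLaw σ a₀ u₀ θ₀ N (Φ N)) Φ ρ u θ 0 → ∀ s t : ℝ, 0 ≤ s → s ≤ t → t < T → ∀ g : T3 → V3, Continuous g → ∀ κ : ℝ, 0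 < κ → ∃ r : ℝ, 0 < r ∧ ∀ φ : T3 → ℝ, Continuous φ → (∀ y, 0 ≤ φ y) → ∫ y, φ y = 1 → (∀ y, r ≤ ‖y‖ → φ y = 0) → Filter.Tendsto (fun N : ℕ => localGibbsLaw σ a₀ u₀ θ₀ N (Φ N) {z | κ < ‖W N σ g s t (fun τ => (Φ N).flow τ z) - ∫ τ in Set.Ioc s t, ∫ x, (3 * (ρK φ ((Φ N).flow τ z) x * θC (ρK φ ((Φ N).flow τ z) x) (mK φ ((Φ N).flow τ z) x) (eK φ ((Φ N).flow τ z) x)) * ζ (ρK φ ((Φ N).flow τ z) x * σ ^ 3)) • g x‖ ∨ κ < |WV N σ g s t (fun τ => (Φ N).flow τ z) - ∫ τ in Set.Ioc s t, ∫ x, (3 * (ρK φ ((Φ N).flow τ z) x * θC (ρK φ ((Φ N).flow τ z) x) (mK φ ((Φ N).flow τ z) x) (eK φ ((Φ N).flow τ z) x)) * ζ (ρK φ ((Φ N).flow τ z) x * σ ^ 3)) / ρK φ ((Φ N).flow τ z) x * inner ℝ (mK φ ((Φ N).flow τ z) x) (g x)|}) Filter.atTop (nhds 0)) → NoConcentrationInBand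 → let ρK : {n : ℕ} → (T3 → ℝ) → Config (n) (Fin 3) T3 → T3 → ℝ := fun φ z x => empiricalDensityField z (fun y => φ (x - y)); let mK : {n : ℕ} → (T3 → ℝ) → Config (n) (Fin 3) T3 → T3 → V3 := fun φ z x => empiricalMomentumField z (fun y => φ (x - y)); let eK : {n : ℕ} → (T3 → ℝ) → Config (n) (Fin 3) T3 → T3 → ℝ := fun φ z x => empiricalEnergyField z (fun y => φ (x - y)); let θC : ℝ → V3 → ℝ → ℝ := fun ρ' m e => 2 / 3 * (e / ρ' - ‖m‖ ^ 2 / (2 * ρ' ^ 2)); let momFlux : ℝ → ℝ → V3 → ℝ → V3 → V3 := fun σ' ρ' m e g => (inner ℝ m g / ρ') • m + hsPressure σ' ρ' (θC ρ' m e) • g; let enFlux : ℝ → ℝ → V3 → ℝ → V3 → ℝ := fun σ' ρ' m e g => (e + hsPressure σ' ρ' (θC ρ' m e)) / ρ' * inner ℝ m g; let momFlux0 : ℝ → V3 → ℝ → V3 → V3 := fun ρ' m e g => (inner ℝ m g / ρ') • m + (ρ' * θC ρ' m e) • g; let enFlux0 : ℝ → V3 → ℝ → V3 → ℝ := fun ρ'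 m e g => (e + ρ' * θC ρ' m e) / ρ' * inner ℝ m g; let W : (N : ℕ) → ℝ → (T3 → V3) → ℝ → ℝ → (ℝ → Config (N + 1) (Fin 3) T3) → V3 := fun N σ' g s t γ => (((N : ℝ) + 1)⁻¹) • ∑ᶠ τ ∈ collisionTimes (Torus.geometry (Fin 3)) (hsDiameter σ' N) γ ∩ Set.Ioc s t, ∑ i : Fin (N + 1), ∑ j : Fin (N + 1), (if i < j then Set.indicator (contactSet (Torus.geometry (Fin 3)) (N + 1) (hsDiameter σ' N) i j) (fun z' => inner ℝ ((Torus.geometry (Fin 3)).sepVec (z' i).1 (z' j).1) ((z' i).2 - (Function.leftLim γ τ i).2) • g (z' i).1) (γ τ) else 0); let WV : (N : ℕ) → ℝ → (T3 → V3) → ℝ → ℝ → (ℝ → Config (N + 1) (Fin 3) T3) → ℝ := fun N σ' g s t γ => (((N : ℝ) + 1)⁻¹) * ∑ᶠ τ ∈ collisionTimes (Torus.geometry (Fin 3)) (hsDiameter σ' N) γ ∩ Set.Ioc s t, ∑ i : Fin (N + 1), ∑ j : Fin (N + 1), (if i < j then Set.indicator (contactSet (Torus.geometry (Fin 3)) (N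 + 1) (hsDiameter σ' N) i j) (fun z' => inner ℝ ((Torus.geometry (Fin 3)).sepVec (z' i).1 (z' j).1) ((z' i).2 - (Function.leftLim γ τ i).2) * inner ℝ (g (z' i).1) ((2 : ℝ)⁻¹ • ((z' i).2 + (z' j).2))) (γ τ) else 0); ∃ η₁ : ℝ, 0 < η₁ ∧ ∀ (a₀ θ₀ : T3 → ℝ) (u₀ : T3 → V3), Continuous a₀ → Continuous θ₀ → Continuous u₀ → (∀ x, 0 < a₀ x) → (∀ x, 0 < θ₀ x) → ∃ σ₀ : ℝ, 0 < σ₀ ∧ ∀ σ : ℝ, 0 < σ → σ < σ₀ → ∀ (T : ℝ) (ρ θ : ℝ → T3 → ℝ) (u : ℝ → T3 → V3), IsHardSphereEulerSolution σ T ρ u θ → (∀ τ ∈ Set.Ico 0 T, ∀ x, ρ τ x * σ ^ 3 < η₁) → ∀ Φ : (N : ℕ) → HardSphereFlow (Torus.geometry (Fin 3)) (hsDiameter σ N) (N + 1), TendstoHydroFieldsAt (fun N => localGibbsLaw σ a₀ u₀ θ₀ N (Φ N)) Φ ρ u θ 0 → ∀ s t : ℝ, 0 ≤ s → s ≤ t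 → t < T → ∀ χ : T3 → ℝ, Torus.IsSmooth χ → ∀ κ : ℝ, 0 < κ → ∃ r : ℝ, 0 < r ∧ ∀ φ : T3 → ℝ, Continuous φ → (∀ y, 0 ≤ φ y) → ∫ y, φ y = 1 → (∀ y, r ≤ ‖y‖ → φ y = 0) → Filter.Tendsto (fun N : ℕ => localGibbsLaw σ a₀ u₀ θ₀ N (Φ N) {z | κ < ‖(3 : ℝ)⁻¹ • W N σ (Torus.gradient χ) s t (fun τ => (Φ N).flow τ z) - ((∫ τ in Set.Ioc s t, ∫ x, momFlux σ (ρK φ ((Φ N).flow τ z) x) (mK φ ((Φ N).flow τ z) x) (eK φ ((Φ N).flow τ z) x) (Torus.gradient χ x)) - (∫ τ in Set.Ioc s t, ∫ x, momFlux0 (ρK φ ((Φ N).flow τ z) x) (mK φ ((Φ N).flow τ z) x) (eK φ ((Φ N).flow τ z) x) (Torus.gradient χ x)))‖ ∨ κ < |(3 : ℝ)⁻¹ * WV N σ (Torus.gradient χ) s t (fun τ => (Φ N).flow τ z) - ((∫ τ in Set.Ioc s t, ∫ x, enFlux σ (ρK φ ((Φ N).flow τ z) x) (mK φ ((Φ N).flow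 τ z) x) (eK φ ((Φ N).flow τ z) x) (Torus.gradient χ x)) - (∫ τ in Set.Ioc s t, ∫ x, enFlux0 (ρK φ ((Φ N).flow τ z) x) (mK φ ((Φ N).flow τ z) x) (eK φ ((Φ N).flow τ z) x) (Torus.gradient χ x)))|}) Filter.atTop (nhds 0)

/-! ## Registered stubs (statement as a `def`, obligation as the sorried `stub_*` theorem) -/

/-- Statement of STUB 1 (M/L, hardest): law of large numbers for the coarse pressure functional
INSIDE the time integral, under the constant-profile local Gibbs laws with field convergence at
every time. -/
def CoarsePressureLLN : Prop :=
  open Literature.MathematicalPhysics.KineticTheory Literature.Analysis.FluidPDE Literature.Analysis.FunctionSpaces in let ρK : {n : ℕ} → (T3 → ℝ) → Config (n) (Fin 3) T3 → T3 → ℝ := fun φ z x => empiricalDensityField z (fun y => φ (x - y)); let mK : {n : ℕ} → (T3 → ℝ) → Config (n) (Fin 3) T3 → T3 → V3 := fun φ z x => empiricalMomentumField z (fun y => φ (x - y)); let eK : {n : ℕ} → (T3 → ℝ) → Config (n) (Fin 3) T3 → T3 → ℝ := fun φ z x => empiricalEnergyField z (fun y => φ (x - y)); let θC : ℝ → V3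 → ℝ → ℝ := fun ρ' m e => 2 / 3 * (e / ρ' - ‖m‖ ^ 2 / (2 * ρ' ^ 2)); ∀ (σ θb : ℝ), 0 < σ → σ ≤ 2⁻¹ → 0 < θb → ∀ Φ : (N : ℕ) → HardSphereFlow (Torus.geometry (Fin 3)) (hsDiameter σ N) (N + 1), (∀ τ : ℝ, 0 ≤ τ → TendstoHydroFieldsAt (fun N => localGibbsLaw σ (fun _ => 1) (fun _ => 0) (fun _ => θb) N (Φ N)) Φ (fun _ _ => 1) (fun _ _ => 0) (fun _ _ => θb) τ) → ∀ ζ : ℝ → ℝ, Continuous ζ → ∀ g : T3 → V3, Continuous g → ∀ s t : ℝ, 0 ≤ s → s ≤ t → ∀ φ : T3 → ℝ, Continuous φ → (∀ y, 0 ≤ φ y) → ∫ y, φ y = 1 → ∀ δ : ℝ, 0 < δ → Filter.Tendsto (fun N : ℕ => localGibbsLaw σ (fun _ => 1) (fun _ => 0) (fun _ => θb) N (Φ N) {z | δ < ‖(∫ τ in Set.Ioc s t, ∫ x, (3 * (ρK φ ((Φ N).flow τ z) x * θC (ρK φ ((Φ N).flow τ z) x) (mK φ ((Φ N).flow τ z)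 x) (eK φ ((Φ N).flow τ z) x)) * ζ (ρK φ ((Φ N).flow τ z) x * σ ^ 3)) • g x) - (3 * θb * ζ (σ ^ 3) * (t - s)) • ∫ x, g x‖}) Filter.atTop (nhds 0)

/-- Statement of STUB 2 (M): along a good in-band trajectory the excess momentum flux IS one third
of the enslaved collision-virial integrand, integrated. -/
def ExcessMomentumIdentity : Prop :=
  open Literature.MathematicalPhysics.KineticTheory Literature.Analysis.FluidPDE Literature.Analysis.FunctionSpaces in let ρK : {n : ℕ} → (T3 → ℝ) → Config (n) (Fin 3) T3 → T3 → ℝ := fun φ z x => empiricalDensityField z (fun y => φ (x - y)); let mK : {n : ℕ} → (T3 → ℝ) → Config (n) (Fin 3) T3 → T3 → V3 := fun φ z x => empiricalMomentumField z (fun y => φ (x - y)); let eK : {n : ℕ} → (T3 → ℝ) → Config (n) (Fin 3) T3 → T3 → ℝ := fun φ z x => empiricalEnergyField z (fun y => φ (x - y)); let θC : ℝ → V3 → ℝ → ℝ := fun ρ' m e => 2 / 3 * (e / ρ' - ‖m‖ ^ 2 / (2 * ρ' ^ 2)); let momFlux : ℝ → ℝ → V3 → ℝ → V3 → V3 :=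 fun σ' ρ' m e g => (inner ℝ m g / ρ') • m + hsPressure σ' ρ' (θC ρ' m e) • g; let momFlux0 : ℝ → V3 → ℝ → V3 → V3 := fun ρ' m e g => (inner ℝ m g / ρ') • m + (ρ' * θC ρ' m e) • g; ∀ (ζ : ℝ → ℝ) (ηs : ℝ), Continuous ζ → (∀ η : ℝ, 0 < η → η ≤ ηs → ζ η = hsCompressibility η - 1) → ∀ (σ : ℝ), 0 < σ → ∀ (N : ℕ) (Φ : HardSphereFlow (Torus.geometry (Fin 3)) (hsDiameter σ N) (N + 1)) (z : Config (N + 1) (Fin 3) T3), z ∈ Φ.good → ∀ (s t : ℝ) (χ : T3 → ℝ), Torus.IsSmooth χ → ∀ (φ : T3 → ℝ), Continuous φ → (∀ y, 0 ≤ φ y) → (∀ τ ∈ Set.Icc s t, ∀ x, ρK φ (Φ.flow τ z) x * σ ^ 3 ≤ ηs) → (∫ τ in Set.Ioc s t, ∫ x, momFlux σ (ρK φ (Φ.flow τ z) x) (mK φ (Φ.flow τ z) x) (eK φ (Φ.flow τ z) x) (Torus.gradient χ x)) - (∫ τ in Set.Ioc s t, ∫ x, momFlux0 (ρK φ (Φ.flow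 τ z) x) (mK φ (Φ.flow τ z) x) (eK φ (Φ.flow τ z) x) (Torus.gradient χ x)) = (3 : ℝ)⁻¹ • ∫ τ in Set.Ioc s t, ∫ x, (3 * (ρK φ (Φ.flow τ z) x * θC (ρK φ (Φ.flow τ z) x) (mK φ (Φ.flow τ z) x) (eK φ (Φ.flow τ z) x)) * ζ (ρK φ (Φ.flow τ z) x * σ ^ 3)) • Torus.gradient χ x

/-- Statement of STUB 3 (M): the energy twin of stub 2. -/
def ExcessEnergyIdentity : Prop :=
  open Literature.MathematicalPhysics.KineticTheory Literature.Analysis.FluidPDE Literature.Analysis.FunctionSpaces in let ρK : {n : ℕ} → (T3 → ℝ) → Config (n) (Fin 3) T3 → T3 → ℝ := fun φ z x => empiricalDensityField z (fun y => φ (x - y)); let mK : {n : ℕ} → (T3 → ℝ) → Config (n) (Fin 3) T3 → T3 → V3 := fun φ z x => empiricalMomentumField z (fun y => φ (x - y)); let eK : {n : ℕ} → (T3 → ℝ) → Config (n) (Fin 3) T3 → T3 → ℝ := fun φ z x => empiricalEnergyField z (fun y => φ (x - y)); let θC : ℝ → V3 → ℝ → ℝ := fun ρ' m e => 2 / 3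 * (e / ρ' - ‖m‖ ^ 2 / (2 * ρ' ^ 2)); let enFlux : ℝ → ℝ → V3 → ℝ → V3 → ℝ := fun σ' ρ' m e g => (e + hsPressure σ' ρ' (θC ρ' m e)) / ρ' * inner ℝ m g; let enFlux0 : ℝ → V3 → ℝ → V3 → ℝ := fun ρ' m e g => (e + ρ' * θC ρ' m e) / ρ' * inner ℝ m g; ∀ (ζ : ℝ → ℝ) (ηs : ℝ), Continuous ζ → (∀ η : ℝ, 0 < η → η ≤ ηs → ζ η = hsCompressibility η - 1) → ∀ (σ : ℝ), 0 < σ → ∀ (N : ℕ) (Φ : HardSphereFlow (Torus.geometry (Fin 3)) (hsDiameter σ N) (N + 1)) (z : Config (N + 1) (Fin 3) T3), z ∈ Φ.good → ∀ (s t : ℝ) (χ : T3 → ℝ), Torus.IsSmooth χ → ∀ (φ : T3 → ℝ), Continuous φ → (∀ y, 0 ≤ φ y) → (∀ τ ∈ Set.Icc s t, ∀ x, ρK φ (Φ.flow τ z) x * σ ^ 3 ≤ ηs) → (∫ τ in Set.Ioc s t, ∫ x, enFlux σ (ρK φ (Φ.flow τ z) x) (mK φ (Φ.flow τ z) x) (eK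 φ (Φ.flow τ z) x) (Torus.gradient χ x)) - (∫ τ in Set.Ioc s t, ∫ x, enFlux0 (ρK φ (Φ.flow τ z) x) (mK φ (Φ.flow τ z) x) (eK φ (Φ.flow τ z) x) (Torus.gradient χ x)) = (3 : ℝ)⁻¹ * ∫ τ in Set.Ioc s t, ∫ x, (3 * (ρK φ (Φ.flow τ z) x * θC (ρK φ (Φ.flow τ z) x) (mK φ (Φ.flow τ z) x) (eK φ (Φ.flow τ z) x)) * ζ (ρK φ (Φ.flow τ z) x * σ ^ 3)) / ρK φ (Φ.flow τ z) x * inner ℝ (mK φ (Φ.flow τ z) x) (Torus.gradient χ x)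

/-- STUB 1 (M/L, hardest). -/
theorem stub_coarsePressureLLN : CoarsePressureLLN := by
  sorry

/-- STUB 2 (M). -/
theorem stub_excessMomentumIdentity : ExcessMomentumIdentity := by
  sorry

/-- STUB 3 (M). -/
theorem stub_excessEnergyIdentity : ExcessEnergyIdentity := by
  sorry

/-! ## Proved ingredients and generic lemmas -/

/-- Continuous probability kernels on `𝕋³` supported in any ball `B_r` (the Literature torus
mollifier `Torus.kernel (min r ¼)`). -/
theorem kernelExists :
    ∀ r : ℝ, 0 < r → ∃ φ : T3 → ℝ, Continuous φ ∧ (∀ y, 0 ≤ φ y) ∧ ∫ y, φ y = 1 ∧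
      ∀ y, r ≤ ‖y‖ → φ y = 0 := by
  intro r hr
  have hε : 0 < min r (1 / 4) := lt_min hr (by norm_num)
  have hε' : min r (1 / 4) ≤ 1 / 4 := min_le_right _ _
  exact ⟨Torus.kernel (min r (1 / 4)), Torus.continuous_kernel hε hε',
    fun y => Torus.kernel_nonneg hε.le y, Torus.integral_kernel hε hε',
    fun y hy => Torus.kernel_eq_zero_of_le hε ((min_le_left _ _).trans hy)⟩

/-- Three vanishing events cannot cover a probability space. -/
theorem false_of_cover {α : ℕ → Type*} [∀ N, MeasurableSpace (α N)] (μ : ∀ N, Measure (α N))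
    [hμ : ∀ N, IsProbabilityMeasure (μ N)] (E1 E2 E3 : ∀ N, Set (α N))
    (h1 : Tendsto (fun N => μ N (E1 N)) atTop (𝓝 0))
    (h2 : Tendsto (fun N => μ N (E2 N)) atTop (𝓝 0))
    (h3 : Tendsto (fun N => μ N (E3 N)) atTop (𝓝 0))
    (hcover : ∀ N z, z ∈ E1 N ∨ z ∈ E2 N ∨ z ∈ E3 N) : False := by
  have h := h1.add (h2.add h3)
  simp only [add_zero] at h
  have hle : ∀ N, (1 : ℝ≥0∞) ≤ μ N (E1 N) + (μ N (E2 N) + μ N (E3 N)) := by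
    intro N
    calc (1 : ℝ≥0∞) = μ N Set.univ := measure_univ.symm
      _ ≤ μ N (E1 N ∪ (E2 N ∪ E3 N)) := measure_mono (fun z _ => by
          rcases hcover N z with h | h | h
          · exact Or.inl h
          · exact Or.inr (Or.inl h)
          · exact Or.inr (Or.inr h))
      _ ≤ μ N (E1 N) + μ N (E2 N ∪ E3 N) := measure_union_le _ _
      _ ≤ μ N (E1 N) + (μ N (E2 N) + μ N (E3 N)) := add_le_add le_rfl (measure_union_le _ _)
  have := ge_of_tendsto' h hle
  exact absurd this (not_le.2 zero_lt_one)

/-- Triangle inequality, covering form. -/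
theorem cover_of_close {E : Type*} [SeminormedAddCommGroup E] (w A a b : E) {δ : ℝ}
    (hδ : 4 * δ < ‖a - b‖) : δ < ‖w - A‖ ∨ δ < ‖A - a‖ ∨ δ < ‖w - b‖ := by
  by_contra h
  simp only [not_or, not_lt] at h
  obtain ⟨h1, h2, h3⟩ := h
  have : ‖a - b‖ ≤ ‖w - b‖ + ‖w - A‖ + ‖A - a‖ := by
    calc ‖a - b‖ = ‖(w - b) - (w - A) - (A - a)‖ := by congr 1; abel
      _ ≤ ‖(w - b) - (w - A)‖ + ‖A - a‖ := norm_sub_le _ _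
      _ ≤ ‖w - b‖ + ‖w - A‖ + ‖A - a‖ := by gcongr; exact norm_sub_le _ _
  linarith [norm_nonneg (w - A), norm_nonneg (A - a), norm_nonneg (w - b)]

/-- `cover_of_close` with a unit scalar in front of the third witness (keeps `(t - s)⁻¹ • W`
syntactic). -/
theorem cover_of_close' {E : Type*} [NormedAddCommGroup E] [NormedSpace ℝ E] (w A a b : E)
    (c : ℝ) (hc : c = 1) {δ : ℝ} (hδ : 4 * δ < ‖a - b‖) :
    δ < ‖w - A‖ ∨ δ < ‖A - a‖ ∨ δ < ‖c • w - b‖ := by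
  subst hc
  rw [one_smul]
  exact cover_of_close w A a b hδ

/-- Union bound + null set + squeeze for measures of `N`-dependent events. -/
theorem tendsto_measure_mono_union_null {α : ℕ → Type*} [∀ N, MeasurableSpace (α N)]
    (μ : ∀ N, Measure (α N)) (A B C G : ∀ N, Set (α N))
    (hA : Tendsto (fun N => μ N (A N)) atTop (𝓝 0))
    (hB : Tendsto (fun N => μ N (B N)) atTop (𝓝 0))
    (hG : ∀ N, μ N (G N)ᶜ = 0)
    (h : ∀ N, ∀ z ∈ C N, z ∈ G N → z ∈ A N ∪ B N) :
    Tendsto (fun N => μ N (C N)) atTop (𝓝 0) := by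
  have h0 : Tendsto (fun N => μ N (A N) + μ N (B N)) atTop (𝓝 0) := by
    simpa using hA.add hB
  refine tendsto_of_tendsto_of_tendsto_of_le_of_le tendsto_const_nhds h0 (fun N => zero_le) ?_
  intro N
  calc μ N (C N) ≤ μ N ((C N ∩ G N) ∪ (G N)ᶜ) := measure_mono (fun z hz => by
          by_cases hG' : z ∈ G N
          · exact Or.inl ⟨hz, hG'⟩
          · exact Or.inr hG')
    _ ≤ μ N (C N ∩ G N) + μ N (G N)ᶜ := measure_union_le _ _
    _ = μ N (C N ∩ G N) := by rw [hG N, add_zero]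
    _ ≤ μ N (A N ∪ B N) := measure_mono (fun z hz => h N z hz.1 hz.2)
    _ ≤ μ N (A N) + μ N (B N) := measure_union_le _ _

/-- Union bound + squeeze for measures of `N`-dependent events. -/
theorem tendsto_measure_mono_union {α : ℕ → Type*} [∀ N, MeasurableSpace (α N)]
    (μ : ∀ N, Measure (α N)) (A B C : ∀ N, Set (α N))
    (hA : Tendsto (fun N => μ N (A N)) atTop (𝓝 0))
    (hB : Tendsto (fun N => μ N (B N)) atTop (𝓝 0))
    (h : ∀ N, C N ⊆ A N ∪ B N) :
    Tendsto (fun N => μ N (C N)) atTop (𝓝 0) := by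
  have h0 : Tendsto (fun N => μ N (A N) + μ N (B N)) atTop (𝓝 0) := by
    simpa using hA.add hB
  refine tendsto_of_tendsto_of_tendsto_of_le_of_le tendsto_const_nhds h0 (fun N => zero_le) ?_
  intro N
  exact (measure_mono (h N)).trans (measure_union_le _ _)

/-- Triangle inequality, contrapositive form. -/
theorem norm_split_half {E : Type*} [SeminormedAddCommGroup E] {a b d : E} {κ : ℝ}
    (h : d = a + b) (hκ : κ < ‖d‖) : κ / 2 < ‖a‖ ∨ κ / 2 < ‖b‖ := by
  by_contra hc
  push Not at hc
  have := norm_add_le a b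
  rw [← h] at this
  linarith [hc.1, hc.2]

/-- Real (absolute value) version of `norm_split_half`. -/
theorem abs_split_half {a b d κ : ℝ}
    (h : d = a + b) (hκ : κ < |d|) : κ / 2 < |a| ∨ κ / 2 < |b| := by
  by_contra hc
  push Not at hc
  have := abs_add_le a b
  rw [← h] at this
  linarith [hc.1, hc.2]

/-! ## Piece 1 from stub 1 -/

set_option maxHeartbeats 1600000 in
/-- PIECE 1 FROM STUB 1 (real proof). -/
theorem VirialResponseCalibration_of :
    CoarsePressureLLN → VirialResponseCalibration := by
  intro hL hVLE hEC
  obtain ⟨ζ, hζc, η₁, hη₁, HV⟩ := hVLE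
  obtain ⟨ηc, hηc, HE⟩ := hEC
  refine ⟨ζ, hζc, ?_, η₁, hη₁, HV⟩
  -- the identification ζ = Z − 1 on a band
  obtain ⟨σ₀, hσ₀, HV1⟩ := HV (fun _ => 1) (fun _ => 1) (fun _ => 0) continuous_const
    continuous_const continuous_const (fun _ => one_pos) (fun _ => one_pos)
  clear HV
  have hm : 0 < min σ₀ 4⁻¹ := lt_min hσ₀ (by norm_num)
  refine ⟨min ((min σ₀ 4⁻¹ / 2) ^ 3) (min (ηc / 2) η₁), by positivity, ?_⟩
  intro η hη hηle
  obtain ⟨σ, hσ, rfl⟩ : ∃ σ : ℝ, 0 < σ ∧ σ ^ 3 = η :=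
    ⟨η ^ (((3 : ℕ) : ℝ)⁻¹), Real.rpow_pos_of_pos hη _, Real.rpow_inv_natCast_pow hη.le (by norm_num)⟩
  have hσle : σ ≤ min σ₀ 4⁻¹ / 2 :=
    le_of_pow_le_pow_left₀ (by norm_num) (by positivity) (hηle.trans (min_le_left _ _))
  have hσσ₀ : σ < σ₀ := by
    have h1 : min σ₀ 4⁻¹ / 2 < min σ₀ 4⁻¹ := by linarith
    exact (hσle.trans_lt h1).trans_le (min_le_left _ _)
  have hσ4 : σ < 4⁻¹ := by
    have h1 : min σ₀ 4⁻¹ / 2 < min σ₀ 4⁻¹ := by linarith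
    exact (hσle.trans_lt h1).trans_le (min_le_right _ _)
  have hσhalf : σ ≤ 2⁻¹ := by linarith
  have hσhalf' : σ ≤ 1 / 2 := by linarith
  have hσhalf'' : σ < 2⁻¹ := by linarith
  have hσc : σ ^ 3 < ηc :=
    lt_of_le_of_lt (hηle.trans ((min_le_right _ _).trans (min_le_left _ _))) (by linarith)
  have hσ1 : σ ^ 3 ≤ η₁ := hηle.trans ((min_le_right _ _).trans (min_le_right _ _))
  -- flows exist (Alexander)
  have hΦ : ∀ N : ℕ, Nonempty (HardSphereFlow (Torus.geometry (Fin 3)) (hsDiameter σ N) (N + 1)) :=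
    fun N => HardSphereFlow.nonempty_torus_holds (hsDiameter_pos hσ N)
      ((hsDiameter_le hσ.le N).trans_lt hσhalf'') (N + 1)
  let Φ : (N : ℕ) → HardSphereFlow (Torus.geometry (Fin 3)) (hsDiameter σ N) (N + 1) :=
    fun N => (hΦ N).some
  -- equilibrium calibration at θ̄ = 1
  obtain ⟨HEa, HEb⟩ := HE 1 one_pos σ hσ hσc Φ
  clear HE
  -- a test vector field with nonzero mean
  obtain ⟨g, hgc, hg0⟩ : ∃ g : T3 → V3, Continuous g ∧ ∫ x, g x ≠ 0 := by
    refine ⟨fun _ => EuclideanSpace.single (0 : Fin 3) (1 : ℝ), continuous_const, ?_⟩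
    rw [integral_const, smul_ne_zero_iff]
    refine ⟨by simp, ?_⟩
    rw [← norm_ne_zero_iff, PiLp.norm_single]
    simp
  by_contra hne
  have hab : (3 * 1 * ζ (σ ^ 3) * (1 - 0)) • ∫ x, g x ≠
      (3 * 1 * (hsCompressibility (σ ^ 3) - 1)) • ∫ x, g x := by
    intro h
    rw [← sub_eq_zero, ← sub_smul, smul_eq_zero] at h
    rcases h with h | h
    · exact hne (by linarith)
    · exact hg0 h
  have hnorm : 0 < ‖((3 * 1 * ζ (σ ^ 3) * (1 - 0)) • ∫ x, g x) -
      (3 * 1 * (hsCompressibility (σ ^ 3) - 1)) • ∫ x, g x‖ := norm_pos_iff.2 (sub_ne_zero.2 hab)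
  have key : ∀ n : ℝ, 0 < n → ∃ δ : ℝ, 0 < δ ∧ 4 * δ < n :=
    fun n hn => ⟨n / 8, by positivity, by linarith⟩
  obtain ⟨δ, hδ, h4δ⟩ := key _ hnorm
  clear key
  -- the enslaved-virial law at equilibrium (constants solve hs-Euler; t = 0 LLN from (a))
  have hsol : IsHardSphereEulerSolution σ 2 (fun _ _ => (1 : ℝ)) (fun _ _ => (0 : V3))
      (fun _ _ => (1 : ℝ)) :=
    isHardSphereEulerSolutionDim_three_iff.1 (IsHardSphereEulerSolutionDim.const σ 2 (0 : V3) one_pos one_pos)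
  obtain ⟨r, hr, HV2⟩ := HV1 σ hσ hσσ₀ 2 (fun _ _ => 1) (fun _ _ => 1) (fun _ _ => 0) hsol
    (fun τ _ x => by show (1 : ℝ) * σ ^ 3 ≤ η₁; rw [one_mul]; exact hσ1) Φ (HEa 0 le_rfl) 0 1 le_rfl
    zero_le_one one_lt_two g hgc _ hδ
  clear HV1
  obtain ⟨φ, hφc, hφnn, hφ1, hφsupp⟩ := kernelExists r hr
  have h1 := HV2 φ hφc hφnn hφ1 hφsupp
  have h2 := hL σ 1 hσ hσhalf one_pos Φ HEa ζ hζc g hgc 0 1 le_rfl zero_le_one φ hφc hφnn hφ1 _ hδ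
  have h3 := HEb 0 1 le_rfl zero_lt_one g hgc _ hδ
  clear HV2 HEb hL
  haveI : ∀ N, IsProbabilityMeasure (localGibbsLaw σ (fun _ => (1 : ℝ)) (fun _ => (0 : V3))
      (fun _ => (1 : ℝ)) N (Φ N)) :=
    fun N => isProbabilityMeasure_localGibbsLaw continuous_const continuous_const continuous_const
      (fun _ => one_pos) (fun _ => one_pos) hσhalf' N (Φ N)
  refine false_of_cover _ _ _ _ h1 h2 h3 ?_
  intro N z
  refine (cover_of_close' _ _ _ _ ((1 : ℝ) - 0)⁻¹ (by norm_num) h4δ).elim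
    (fun h => Or.inl (Or.inl h))
    (fun h => h.elim (fun h => Or.inr (Or.inl h)) (fun h => Or.inr (Or.inr h)))


/-! ## Piece 2 from stubs 2–3 -/

theorem ExcessFluxTransferInBand_of :
    ExcessMomentumIdentity → ExcessEnergyIdentity → ExcessFluxTransferInBand := by
  intro hM hE hV hN
  obtain ⟨ζ, hζc, ⟨ηs, hηs, hcal⟩, η₁v, hη₁v, HV⟩ := hV
  obtain ⟨η₁n, hη₁n, HN⟩ := hN
  refine ⟨min (min η₁v η₁n) (ηs / 2), lt_min (lt_min hη₁v hη₁n) (half_pos hηs), ?_⟩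
  intro a₀ θ₀ u₀ ha hθ hu hap hθp
  obtain ⟨σ₀v, hσ₀v, HV1⟩ := HV a₀ θ₀ u₀ ha hθ hu hap hθp
  obtain ⟨σ₀n, hσ₀n, HN1⟩ := HN a₀ θ₀ u₀ ha hθ hu hap hθp
  clear HV HN
  refine ⟨min σ₀v σ₀n, lt_min hσ₀v hσ₀n, ?_⟩
  intro σ hσ hσlt T ρ θ u hsol hguard Φ h0 s t hs hst htT χ hχ κ hκ
  have hg : Continuous (Literature.Analysis.FunctionSpaces.Torus.gradient χ) :=
    (hχ.gradient).continuous
  obtain ⟨r, hr, HV3⟩ := HV1 σ hσ (hσlt.trans_le (min_le_left _ _)) T ρ θ u hsol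
    (fun τ hτ x => ((hguard τ hτ x).trans_le ((min_le_left _ _).trans (min_le_left _ _))).le)
    Φ h0 s t hs hst htT _ hg (3 * κ) (by positivity)
  refine ⟨r, hr, ?_⟩
  intro φ hφc hφnn hφ1 hφsupp
  have HV4 := HV3 φ hφc hφnn hφ1 hφsupp
  have HN4 := HN1 σ hσ (hσlt.trans_le (min_le_right _ _)) T ρ θ u hsol
    (fun τ hτ x => (hguard τ hτ x).trans_le ((min_le_left _ _).trans (min_le_right _ _)))
    Φ h0 t ⟨hs.trans hst, htT⟩ 2 one_lt_two φ hφc hφnn hφ1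
  clear HV1 HN1 HV3
  refine tendsto_measure_mono_union_null _ _ _ _ (fun N => (Φ N).good) HV4 HN4
    (fun N => mem_ae_iff.1 (Literature.MathematicalPhysics.KineticTheory.ae_mem_good_localGibbsLaw σ a₀ u₀ θ₀ N (Φ N))) ?_
  intro N z hz hzG
  by_contra hnot
  simp only [Set.mem_union, not_or] at hnot
  obtain ⟨hnotA, hnotB⟩ := hnot
  -- the band from the no-concentration event and the packing guard
  have hband : ∀ τ ∈ Set.Icc s t, ∀ x,
      Literature.MathematicalPhysics.KineticTheory.empiricalDensityField ((Φ N).flow τ z)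
        (fun y => φ (x - y)) * σ ^ 3 ≤ ηs := by
    intro τ hτ x
    simp only [Set.mem_setOf_eq, not_exists, not_and, not_or] at hnotB
    have hτ' : τ ∈ Set.Icc 0 t := ⟨hs.trans hτ.1, hτ.2⟩
    obtain ⟨-, h2, -⟩ := hnotB τ hτ' x
    push Not at h2
    obtain ⟨τ', hτ'mem, x', hx'⟩ := h2
    have hg' := hguard τ' ⟨hτ'mem.1, hτ'mem.2.trans_lt htT⟩ x'
    have hσ3 : 0 < σ ^ 3 := by positivity
    have hη : min (min η₁v η₁n) (ηs / 2) ≤ ηs / 2 := min_le_right _ _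
    nlinarith [mul_le_mul_of_nonneg_right hx' hσ3.le]
  have hIM := hM ζ ηs hζc hcal σ hσ N (Φ N) z hzG s t χ hχ φ hφc hφnn hband
  have hIE := hE ζ ηs hζc hcal σ hσ N (Φ N) z hzG s t χ hχ φ hφc hφnn hband
  apply hnotA
  simp only [Set.mem_setOf_eq] at hz ⊢
  rw [hIM, hIE] at hz
  rcases hz with hz | hz
  · left
    rw [← smul_sub, norm_smul, Real.norm_eq_abs, abs_of_pos (by norm_num : (0:ℝ) < 3⁻¹)] at hz
    linarith
  · right
    rw [← mul_sub, abs_mul, abs_of_pos (by norm_num : (0:ℝ) < 3⁻¹)] at hz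
    linarith


/-! ## Assembly (the glue item of the split, step (iii) of the crux)

Stated with the crux UNFOLDED (`CalibratedClosureInBand` is by definition this implication) so that
`CalibratedClosureInBand_of` below is the only theorem concluding the crux by name (skeleton check). -/

theorem calibratedClosureInBand_of_pieces :
    VirialResponseCalibration → ExcessFluxTransferInBand →
    (StressIsotropy → VirialLocalEquilibrium → EquilibriumCalibration → NoConcentrationInBand →
      FluxLocalityInBand) := by
  intro h1 h2 hSI hVLE hEC hNC
  have hCVL := h2 (h1 hVLE hEC) hNC
  clear h1 h2 hVLE hEC hNC
  obtain ⟨η₁s, hη₁s, HS⟩ := hSI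
  obtain ⟨η₁c, hη₁c, HC⟩ := hCVL
  refine ⟨min η₁s η₁c, lt_min hη₁s hη₁c, ?_⟩
  intro a₀ θ₀ u₀ ha hθ hu hap hθp
  obtain ⟨σ₀s, hσ₀s, HS1⟩ := HS a₀ θ₀ u₀ ha hθ hu hap hθp
  obtain ⟨σ₀c, hσ₀c, HC1⟩ := HC a₀ θ₀ u₀ ha hθ hu hap hθp
  clear HS HC
  refine ⟨min σ₀s σ₀c, lt_min hσ₀s hσ₀c, ?_⟩
  intro σ hσ hσlt T ρ θ u hsol hguard Φ h0 s t hs hst htT χ hχ κ hκ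
  obtain ⟨rs, hrs, HS3⟩ := HS1 σ hσ (hσlt.trans_le (min_le_left _ _)) T ρ θ u hsol
    (fun τ hτ x => ((hguard τ hτ x).trans_le (min_le_left _ _)).le) Φ h0 s t hs hst htT χ hχ
    (κ / 2) (half_pos hκ)
  obtain ⟨rc, hrc, HC3⟩ := HC1 σ hσ (hσlt.trans_le (min_le_right _ _)) T ρ θ u hsol
    (fun τ hτ x => (hguard τ hτ x).trans_le (min_le_right _ _)) Φ h0 s t hs hst htT χ hχ
    (κ / 2) (half_pos hκ)
  clear HS1 HC1
  refine ⟨min rs rc, lt_min hrs hrc, ?_⟩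
  intro φ hφc hφnn hφ1 hφsupp
  have HS4 := HS3 φ hφc hφnn hφ1 (fun y hy => hφsupp y ((min_le_left _ _).trans hy))
  have HC4 := HC3 φ hφc hφnn hφ1 (fun y hy => hφsupp y ((min_le_right _ _).trans hy))
  clear HS3 HC3
  constructor
  · refine tendsto_measure_mono_union _ _ _ _ HS4 HC4 ?_
    intro N z hz
    simp only [Set.mem_setOf_eq, Set.mem_union] at hz ⊢
    refine (norm_split_half ?_ hz).imp Or.inl Or.inl
    abel
  · refine tendsto_measure_mono_union _ _ _ _ HS4 HC4 ?_
    intro N z hz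
    simp only [Set.mem_setOf_eq, Set.mem_union] at hz ⊢
    refine (abs_split_half ?_ hz).imp Or.inr Or.inr
    ring


/-! ## The crux from the three stubs -/

/-- THE COMPOSITION: the three registered stubs give the crux `CalibratedClosureInBand` BY NAME
(no hypotheses; the only `sorry`s are inside `stub_*`). -/
theorem CalibratedClosureInBand_of : CalibratedClosureInBand :=
  calibratedClosureInBand_of_pieces (VirialResponseCalibration_of stub_coarsePressureLLN)
    (ExcessFluxTransferInBand_of stub_excessMomentumIdentity stub_excessEnergyIdentity)

end Summit.AtomisticToContinuum.HydrodynamicLimit.Cruxes.CalibratedClosureInBand.CalibratedSplit
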